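import Summits.ABC.IUTFork.Joshi.DictionaryTensorPackets
import Summits.ABC.IUTFork.Joshi.TestIsmScaling
import HarnessLib

/-!
# Block E, test of dictionary row D-09 — §9.4 STRICT CARRIER MOVES: the two horns of `LocalIsosInInd`

Proof-only TEST file (D-0012; R14 `Joshi/Test*.lean`; five small model-data definitions, NO `Prop` fact, no `sorry`) of the
abc-iut cell, block E «type Joshi's construction, test vs S» (rung LADDER-ABC:A2.E; seat abc-iut-E-t20, slot T-20 = K. Joshi,
*Construction of Arithmetic Teichmüller Spaces III*, arXiv:2401.13508 **v4** = `Joshi2024ATS3`, §9.4 «Mochizuki's tensor-packet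
codomain», typed in `TensorPacketsJoshi*.lean` p429434 / p429647+p430478 / p430055 / p430386 and bound to OUR side in
`DictionaryTensorPackets.lean` p430617). TAKES NO SIDE on [IUTchIII] Cor. 3.12, on Joshi's claims or on Mochizuki's report on them;
typed ≠ proved; typed AS A CANDIDATE ≠ endorsed; a model EXHIBITS satisfiability of typed hypotheses, nothing more; the cell locates /
conditionally verifies — NO abc claim.

WHAT IS TESTED. Row D-09's binding (p430617) isolates, for a dictionary `𝔇` (abc-iut-E-plan, `Dictionary.lean`) whose moves act on
`𝓘^ℚ_Mochizuki(L')` as §9.4 lets them — through isomorphisms of the LOCAL log-shell carriers along an `ℓ*+1`-tuple of arithmeticoids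
(Rmk. 9.4.8.2 p.105 l.53–66; Prop. 9.7.5.1 p.112 summandwise), i.e. `RealisedByStrictMoves 𝔇 𝔗 G z` —, ONE residual condition under
which E-plan's X-01 glue fires: `LocalIsosInInd 𝔇 𝔗 G` («every local component is a `𝒟^⊢`-strip automorphism, or every local component
is an element of Ism»). This file records, in kernel currency:

§1 (generic) `LocalIsosInInd` HOLDS whenever `Ism` is everything (`localIsosInInd_of_ism_univ`) and FAILS as soon as ONE local component
   lies outside `stripAut ∪ Ism` (`not_localIsosInInd_of_component`).
§2 (structure of strict moves, over the pinned ℚ-line carriers `lineShells A I` of abc-iut-E-t41, for ANY reading `A`/`I` of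
   strip-automorphisms / Ism) **a §9.4 strict move is CUMULATIVE along the tuple**: if the move rescales the carrier of the arithmeticoid
   `y` by `c(y)`, it acts on the label-`j` packet line by the PRODUCT `∏_{a ∈ S_{j+1}} c(z_a)` (`line_strictMove_scalar`) — one factor
   per member of Mochizuki's capsule `S_{j+1}(z) = {z_0,…,z_j}` (§9.4.5) —, not by a freely chosen label-wise scalar.
§3 (the telescoping realisation) along the standard tuple `z_Θ = (y′_0, y′_1, …, y′_{ℓ*})` (§9.4.4 p.102 l.22–28; arithmeticoids indexed by
   the labels, `labelDatum`) the scalars `c(y′_0) = p`, `c(y′_a) = p^{(a−1)² − a²}` (`teleExp`) have cumulative product `p^{1−j²}` at label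
   `j` (`prod_teleUnit`), so the induced strict move IS abc-iut-E-t41's untilt-change family `untiltFamily` («`p^{1−j²}` on the factor `0`»,
   TestIsmScalingShells p431238; [J-III] Thm. 4.2.2.1 (4) eq. (4.2.2.2) p.33 read by §8.11.1 p.91 as Mochizuki's (Ind2)):
   `strictMove_tele_eq_untiltFamily` — the two typings of «Joshi's move on the codomain» meet in the kernel.
§4 THE (+) HORN at the X-07′ carriers `scalShells` (Ism := ALL ℚ-linear automorphisms, [J-III] p.91 l.44–46; TestIsmScaling p431588):
   every dictionary realising its moves by `untiltFamily` is `RealisedByStrictMoves` along `z_Θ`, `LocalIsosInInd` holds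
   (`scal_localIsosInInd`), hence `MovesAreInd` BY THE §9.4 ROUTE (`scal_movesAreInd_of_real_eq`) and, with the other X-01 hypotheses, S for
   any setting / region reading / q-datum over that situation (`scal_pilotKummerIndRelated_of_real_eq` — a FILLS-MODULO shape; the
   NON-DEGENERATE dictionary there is abc-iut-E-t41's part III at `scalSetting`/`scalRegion`/`qDatum`, which meets the hypothesis
   `∀ g, 𝔇.real g = untiltFamily p` by `rfl`; the typed Statement FAILS there, TestIsmScalingResults p431886).
§5 THE (−) HORN at the model of record `signShells` (Ism = stripAut = `{±1}`, abc-iut-w4-d101's pinned countermodel p419720): the SAME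
   realisation violates `LocalIsosInInd` (`p ∉ {±1}`, `pinned_not_localIsosInInd_tele`; any `p^a`-component, `a ≠ 0`, does), and for EVERY
   `(𝔇, 𝔗, G, z)`: `RealisedByStrictMoves ∧ LocalIsosInInd ∧ BaseIsThetaPilot ∧ DatumEquivariant ∧ StdReachable ⟹ ¬StandardPointIsQPilot`
   (`pinned_strictMoves_not_stdIsQPilot`, from abc-iut-E-cx's X-02 / `pinnedSetting_not_pilotKummerIndRelated`); sign-valued realisations
   DO satisfy `LocalIsosInInd` there (`pinned_localIsosInInd_of_signs`) — and are (Ind)-trivial on regions (X-06, p428758 / p429312).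
LOCATED, NOT ADJUDICATED: the two carriers differ in the single field `LogShells.ism` ([IUTchII] Ex. 1.8 (iv) / [IUTchIII] Prop. 1.2 (vi)
«Ism» ↔ [J-III] §8.11.1 «ℚ_p-linear isomorphisms σ», E-LOCATION §L1; E6 attach point). Interface level over c312-7's one-place index
`toyIndex` (`ℓ* = 2`). [claim: Joshi2024ATS3, status: disputed] [claim: Mochizuki2012, status: disputed] [cite: ScholzeStix2018, §2.2 pp. 9–10]
-/

noncomputable section

open Set

namespace Summit.ABC.IUTFork.Joshi

open Thm311 Cor312 Cor312Vol Cor312.Checks Cor312.IdentifiedNonVacuity Cor312Vol.NaiveWitness Cor312Vol.PinnedWitness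
  Literature.IUT.LogThetaLattice IsmScaling

/-! ## 1. Generic: when `LocalIsosInInd` holds and when it fails -/

section Generic

variable {T : ThetaIndex} {S : LatticeSituation T} (𝔇 : Dictionary S) (𝔗 : TensorPacketDatum T)
  (G : 𝔇.Move → 𝔗.Arith → ∀ w : T.V, S.L.carrier w ≃ₗ[ℚ] S.L.carrier w)

/-- If EVERY local component of every move is an element of Ism, `LocalIsosInInd` holds (its (Ind2) disjunct). [folklore] -/
theorem localIsosInInd_of_forall_mem_ism (h : ∀ (g : 𝔇.Move) (y : 𝔗.Arith) (w : T.V), G g y w ∈ S.L.ism w) :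
    LocalIsosInInd 𝔇 𝔗 G :=
  fun g => Or.inr (h g)

/-- If EVERY local component of every move is a `𝒟^⊢`-strip automorphism, `LocalIsosInInd` holds (its (Ind1) disjunct). [folklore] -/
theorem localIsosInInd_of_forall_mem_stripAut (h : ∀ (g : 𝔇.Move) (y : 𝔗.Arith) (w : T.V), G g y w ∈ S.L.stripAut w) :
    LocalIsosInInd 𝔇 𝔗 G :=
  fun g => Or.inl (h g)

/-- **`Ism = everything` ⟹ `LocalIsosInInd`**: at an instantiation whose "Ism" is ALL ℚ-linear automorphisms of each carrier (Joshi's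
«ℚ_p-linear isomorphisms σ», [J-III] §8.11.1 p.91 l.44–46, as abc-iut-E-t41's `scalShells` types it) the residual condition of row D-09
holds for EVERY realisation `G`. [folklore] -/
theorem localIsosInInd_of_ism_univ (hI : ∀ w : T.V, S.L.ism w = Set.univ) : LocalIsosInInd 𝔇 𝔗 G :=
  localIsosInInd_of_forall_mem_ism 𝔇 𝔗 G fun _ _ w => by rw [hI w]; exact Set.mem_univ _

/-- **One bad component kills `LocalIsosInInd`**: if some local component `G g y w` is neither a strip automorphism nor an element of
Ism, the condition fails (both disjuncts quantify over all `(y, w)`). [folklore] -/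
theorem not_localIsosInInd_of_component (g : 𝔇.Move) (y : 𝔗.Arith) (w : T.V) (hA : G g y w ∉ S.L.stripAut w)
    (hI : G g y w ∉ S.L.ism w) : ¬ LocalIsosInInd 𝔇 𝔗 G :=
  fun h => (h g).elim (fun h1 => hA (h1 y w)) fun h2 => hI (h2 y w)

end Generic

/-! ## 2. Strict moves over the pinned ℚ-line carriers are CUMULATIVE along the tuple -/

section Cumulative

/-- **The §9.4 datum along the standard tuple**: arithmeticoids indexed by the labels — `y′_0, y′_1, …, y′_{ℓ*}`, the entries of
`z_Θ = (y′_0, y′_1, …, y′_{ℓ*})` ([J-III] §9.4.4 p.102 l.22–28), pairwise distinct untilts —, every tuple admitted, `z_Θ := id`. MODEL DATA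
for the tests below (the smallest `TensorPacketDatum` in which the standard tuple has distinct entries). [claim: Joshi2024ATS3, status: disputed] -/
def labelDatum (T : ThetaIndex) : TensorPacketDatum T where
  Arith := T.Label
  ansatzGraph := Set.univ
  zTheta := id
  zTheta_mem := Set.mem_univ _

/-- A realisation by PER-ARITHMETICOID SCALARS on the ℚ-line carriers: the move rescales the carrier `log(𝒟^⊢_w)` attached to the
arithmeticoid `y` by the unit `c(y)` (the shape of a valuation-rescaling «ℚ_p-linear isomorphism σ», [J-III] p.91 l.44–46 / Thm. 4.2.2.1
(4); over the one-place index every carrier automorphism is such a scalar, abc-iut-E-t41's `exists_scalar`). MODEL DATA. [folklore] -/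
def scalarMoves {X : Type} (c : X → ℚˣ) : X → toyIndex.V → (ℚ ≃ₗ[ℚ] ℚ) := fun y _ => LinearEquiv.smulOfUnit (c y)

variable (A I : Set (ℚ ≃ₗ[ℚ] ℚ)) (hA : LinearEquiv.refl ℚ ℚ ∈ A) (hI : LinearEquiv.refl ℚ ℚ ∈ I)

/-- **Strict moves are CUMULATIVE along the tuple.** Over abc-iut-E-t41's ℚ-line shells `lineShells A I` (ANY reading `A`, `I` of
strip-automorphisms / Ism over the pinned carriers) the §9.4 strict move along the tuple `z` induced by per-arithmeticoid scalars `c`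
acts on the label-`j` packet line `⊗_{a ∈ S_{j+1}} log(𝒟^⊢)` as multiplication by the PRODUCT `∏_{a ∈ S_{j+1}} c(z_a)` — one factor per
member of the capsule `S_{j+1}(z) = {z_0,…,z_j}` ([J-III] §9.4.5–9.4.6, (9.4.6.2)). [folklore] -/
theorem line_strictMove_scalar (𝔗 : TensorPacketDatum toyIndex) (c : 𝔗.Arith → ℚˣ) (z : toyIndex.Label → 𝔗.Arith)
    (j : toyIndex.Label) (vQ : toyIndex.VQ) (x : signShells.Packet j vQ) :
    line j vQ (𝔗.strictMove (lineShells A I hA hI) (scalarMoves c) z j vQ x) =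
      (∏ a : toyIndex.Caps j, (c (𝔗.capsEntry z j a) : ℚ)) * line j vQ x :=
  line_factorwise_of_smul j vQ _ (fun a => (c (𝔗.capsEntry z j a) : ℚ)) (fun _ y => by funext v; rfl) x

/-- … so it carries the ball `B_k` onto `B_{k + v_p(∏_a c(z_a))}`. [folklore] -/
theorem image_pBall_strictMove_scalar (p : ℕ) [Fact p.Prime] (𝔗 : TensorPacketDatum toyIndex) (c : 𝔗.Arith → ℚˣ)
    (z : toyIndex.Label → 𝔗.Arith) (j : toyIndex.Label) (vQ : toyIndex.VQ) (k : ℤ) :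
    𝔗.strictMove (lineShells A I hA hI) (scalarMoves c) z j vQ '' pBall p j vQ k =
      pBall p j vQ (k + padicValRat p (∏ a : toyIndex.Caps j, (c (𝔗.capsEntry z j a) : ℚ))) :=
  image_pBall_of_scalar p (by rw [← Units.coe_prod]; exact Units.ne_zero _)
    (line_strictMove_scalar A I hA hI 𝔗 c z j vQ) k

/-! ## 3. The telescoping realisation of Joshi's untilt change as a strict move along `z_Θ` -/

/-- **Telescoping exponents**: `e_0 = 1`, `e_a = (a−1)² − a²` (`a ≥ 1`) — the valuations of the per-arithmeticoid scalars
`c(y′_a) = p^{e_a}` whose cumulative products are `p^{1−j²}`. MODEL DATA. [folklore] -/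
def teleExp (a : ℕ) : ℤ := if a = 0 then 1 else (((a - 1) ^ 2 : ℕ) : ℤ) - ((a ^ 2 : ℕ) : ℤ)

/-- `∑_{a ≤ n} e_a = 1 − n²` (telescoping). [folklore] -/
theorem sum_range_teleExp (n : ℕ) : ∑ i ∈ Finset.range (n + 1), teleExp i = 1 - ((n ^ 2 : ℕ) : ℤ) := by
  induction n with
  | zero => simp [teleExp]
  | succ n ih =>
      rw [Finset.sum_range_succ, ih]
      simp only [teleExp, Nat.succ_ne_zero, if_false, Nat.add_sub_cancel]
      push_cast
      ring

/-- `∏_{i ∈ s} p^{f i} = p^{∑_{i ∈ s} f i}` in `ℚ`. [folklore] -/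
theorem prod_ppow_eq_ppow_sum (p : ℕ) [hp : Fact p.Prime] {ι : Type} (s : Finset ι) (f : ι → ℤ) :
    ∏ i ∈ s, (p : ℚ) ^ f i = (p : ℚ) ^ ∑ i ∈ s, f i := by
  classical
  induction s using Finset.induction_on with
  | empty => simp
  | insert a s ha ih =>
      rw [Finset.prod_insert ha, Finset.sum_insert ha, ih, zpow_add₀ (Nat.cast_ne_zero.2 hp.out.ne_zero)]

variable (p : ℕ) [hp : Fact p.Prime]

/-- The per-arithmeticoid units `c(y′_a) := p^{e_a}` along `z_Θ`. MODEL DATA. [folklore] -/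
def teleUnit (a : toyIndex.Label) : ℚˣ := ppowUnit p (teleExp a)

/-- **The telescoping realisation** `G(y′_a)_w := (x ↦ p^{e_a}·x)` on every carrier. MODEL DATA. [folklore] -/
def teleG : toyIndex.Label → toyIndex.V → (ℚ ≃ₗ[ℚ] ℚ) := scalarMoves (teleUnit p)

/-- The component of `teleG` at the arithmeticoid `y′_0` is the scaling by `p`. [folklore] -/
theorem teleG_zero (w : toyIndex.V) : teleG p 0 w = LinearEquiv.smulOfUnit (ppowUnit p 1) := rfl

/-- **The cumulative product at label `j` is `p^{1−j²}`.** [folklore] -/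
theorem prod_teleUnit (j : toyIndex.Label) :
    (∏ a : toyIndex.Caps j, (teleUnit p ((labelDatum toyIndex).capsEntry id j a) : ℚ)) = (p : ℚ) ^ (1 - jsq j) := by
  have h1 : (∏ a : toyIndex.Caps j, (teleUnit p ((labelDatum toyIndex).capsEntry id j a) : ℚ)) =
      ∏ a : Fin ((j : ℕ) + 1), (p : ℚ) ^ teleExp a := rfl
  rw [h1, prod_ppow_eq_ppow_sum, Fin.sum_univ_eq_sum_range (fun i => teleExp i) ((j : ℕ) + 1), sum_range_teleExp]
  rfl

/-- The strict move along `z_Θ` induced by `teleG` acts on the label-`j` packet line by `p^{1−j²}` (for any reading `A`, `I`). [folklore] -/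
theorem line_strictMove_tele (j : toyIndex.Label) (vQ : toyIndex.VQ) (x : signShells.Packet j vQ) :
    line j vQ ((labelDatum toyIndex).strictMove (lineShells A I hA hI) (teleG p) id j vQ x) = (p : ℚ) ^ (1 - jsq j) * line j vQ x := by
  rw [← prod_teleUnit p j]
  exact line_strictMove_scalar A I hA hI (labelDatum toyIndex) (teleUnit p) id j vQ x

/-- … and carries `B_k` onto `B_{k+1−j²}`: at `j ∈ 𝔽_l^⋆` the Θ-region `B_{j²}` onto the q-region `B_1` (for any reading `A`, `I` — the
MAP exists over the pinned carriers; whether it is an indeterminacy is the field `ism`). [folklore] -/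
theorem image_pBall_strictMove_tele (j : toyIndex.Label) (vQ : toyIndex.VQ) (k : ℤ) :
    (labelDatum toyIndex).strictMove (lineShells A I hA hI) (teleG p) id j vQ '' pBall p j vQ k = pBall p j vQ (k + (1 - jsq j)) :=
  (image_pBall_of_scalar p (ppow_ne_zero p (1 - jsq j)) (line_strictMove_tele A I hA hI p j vQ) k).trans
    (by rw [padicValRat_ppow])

/-- **The two typings of «Joshi's untilt change acting on the codomain» MEET**: the §9.4 strict move along `z_Θ = (y′_0, y′_1, y′_2)` with the
telescoping per-arithmeticoid scalars IS abc-iut-E-t41's (Ind2)-family `untiltFamily` («`p^{1−j²}` on the factor `0` at label `j`»,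
TestIsmScalingShells) — as elements of `PacketAut` of the Joshi-style shells (packet lines are ℚ-lines, so an automorphism is determined
by its scalar). [folklore] -/
theorem strictMove_tele_eq_untiltFamily : (labelDatum toyIndex).strictMove scalShells (teleG p) id = untiltFamily p := by
  funext j vQ
  refine LinearEquiv.ext fun x => (line j vQ).injective ?_
  have h1 := line_strictMove_tele signs Set.univ (Set.mem_insert _ _) (Set.mem_univ _) p j vQ x
  have h2 : line j vQ (untiltFamily p j vQ x) = (p : ℚ) ^ (1 - jsq j) * line j vQ x := by
    rw [untiltFamily, line_scaleFamily]
    rfl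
  exact h1.trans h2.symm

end Cumulative

/-! ## 4. The (+) horn: at the X-07′ carriers the D-09 route fires -/

section PlusHorn

variable (p : ℕ) [hp : Fact p.Prime] (𝔇 : Dictionary (scalFull p).toLatticeSituation)

omit hp in
/-- **`LocalIsosInInd` HOLDS at the Joshi-style shells for EVERY realisation** (`ism := univ`). [folklore] -/
theorem scal_localIsosInInd (𝔗 : TensorPacketDatum toyIndex)
    (G : 𝔇.Move → 𝔗.Arith → ∀ w : toyIndex.V, scalShells.carrier w ≃ₗ[ℚ] scalShells.carrier w) : LocalIsosInInd 𝔇 𝔗 G :=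
  localIsosInInd_of_ism_univ 𝔇 𝔗 G fun _ => rfl

/-- **Every dictionary over the X-07′ situation realising its moves by the untilt-change family is `RealisedByStrictMoves`** along `z_Θ`
by the telescoping scalars (abc-iut-E-t41's non-degenerate dictionary of the X-01 model slot meets the hypothesis by `rfl`). [folklore] -/
theorem scal_realisedByStrictMoves_of_real_eq (h : ∀ g : 𝔇.Move, 𝔇.real g = untiltFamily p) :
    RealisedByStrictMoves 𝔇 (labelDatum toyIndex) (fun _ => teleG p) (fun _ => id) := fun g => by
  rw [h g]
  exact (strictMove_tele_eq_untiltFamily p).symm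

/-- … hence `MovesAreInd` BY THE §9.4 ROUTE of row D-09 (`movesAreInd_of_strictMoves`, p430617) — the X-01 load-bearing hypothesis
obtained from `RealisedByStrictMoves ∧ LocalIsosInInd`, both of which HOLD here. [folklore] -/
theorem scal_movesAreInd_of_real_eq (h : ∀ g : 𝔇.Move, 𝔇.real g = untiltFamily p) : MovesAreInd 𝔇 :=
  movesAreInd_of_strictMoves 𝔇 (labelDatum toyIndex) (fun _ => teleG p) (fun _ => id)
    (scal_realisedByStrictMoves_of_real_eq p 𝔇 h) (scal_localIsosInInd p 𝔇 _ _)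

/-- **The (+) horn, S-form** (FILLS-MODULO shape of p430617 with its two D-09 hypotheses DISCHARGED at the X-07′ carriers): for such a
dictionary and ANY setting `P` over the X-07′ situation, region reading `ρ` and q-datum `qK`, `BaseIsThetaPilot ∧ DatumEquivariant ∧
StdReachable ∧ StandardPointIsQPilot` give S = `PilotKummerIndRelated` (instance of record: abc-iut-E-t41's `scalSetting p` /
`scalRegion p` / `qDatum p`, where its part III dictionary meets all four and the typed Statement FAILS, p431886). A LOCATION, never
evidence toward S at the model of record; `StandardPointIsQPilot` rides STRONGER-THAN-PRINT (E-PLAN R15). [folklore] -/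
theorem scal_pilotKummerIndRelated_of_real_eq (P : Cor312.Setting (scalFull p).toSituation)
    (ρ : (∀ v : toyIndex.V, v ∈ toyIndex.Vbad → Set (scalShells.StarPacket v)) →
      ∀ (j : toyIndex.Label) (vQ : toyIndex.VQ), Set (scalShells.Packet j vQ))
    (qK : ∀ v : toyIndex.V, v ∈ toyIndex.Vbad → Set (scalShells.StarPacket v))
    (h : ∀ g : 𝔇.Move, 𝔇.real g = untiltFamily p)
    (hB : BaseIsThetaPilot 𝔇 (P := P)) (hE : DatumEquivariant 𝔇) (hS : StdReachable 𝔇)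
    (hQ : StandardPointIsQPilot ρ qK 𝔇) :
    PilotKummerIndRelated (scalFull p).toLatticeSituation P ρ qK :=
  pilotKummerIndRelated_of_strictMoves ρ qK 𝔇 (labelDatum toyIndex) (fun _ => teleG p) (fun _ => id)
    (scal_realisedByStrictMoves_of_real_eq p 𝔇 h) (scal_localIsosInInd p 𝔇 _ _) hB hE hS hQ

end PlusHorn

/-! ## 5. The (−) horn: at the model of record the same realisation violates `LocalIsosInInd` -/

section MinusHorn

variable (p : ℕ) [hp : Fact p.Prime]

/-- A valuation-rescaling `x ↦ p^a·x`, `a ≠ 0`, is NOT a sign: it is not in `{±1}` = Ism = stripAut of the model of record. [folklore] -/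
theorem smul_ppow_not_mem_signs {a : ℤ} (ha : a ≠ 0) : (LinearEquiv.smulOfUnit (ppowUnit p a) : ℚ ≃ₗ[ℚ] ℚ) ∉ signs := by
  have key : ∀ s : ℚ, padicValRat p s = 0 → (p : ℚ) ^ a * 1 ≠ s := fun s hs h => by
    have hv := padicValRat_ppow p a
    rw [mul_one] at h
    rw [h, hs] at hv
    exact ha hv.symm
  rintro (h | h)
  · exact key 1 padicValRat.one (LinearEquiv.congr_fun h 1)
  · have h' : (LinearEquiv.smulOfUnit (ppowUnit p a) : ℚ ≃ₗ[ℚ] ℚ) = LinearEquiv.neg ℚ := h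
    refine key (-1) (by rw [padicValRat.neg]; exact padicValRat.one) ?_
    have h1 := LinearEquiv.congr_fun h' 1
    rw [LinearEquiv.neg_apply] at h1
    exact h1

variable (𝔇 : Dictionary (naiveFull p).toLatticeSituation)

/-- **The telescoping realisation violates `LocalIsosInInd` at the model of record** (one move suffices: its component at `y′_0` is
the scaling by `p ∉ {±1}`). Together with §4: the SAME realisation data `(labelDatum, teleG, z_Θ)` satisfy the D-09 residual condition at
`scalShells` and violate it at `signShells` — the two carriers differ in the field `ism` only. [folklore] -/
theorem pinned_not_localIsosInInd_tele (g : 𝔇.Move) : ¬ LocalIsosInInd 𝔇 (labelDatum toyIndex) (fun _ => teleG p) :=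
  not_localIsosInInd_of_component 𝔇 (labelDatum toyIndex) (fun _ => teleG p) g (0 : toyIndex.Label) ()
    (smul_ppow_not_mem_signs p one_ne_zero) (smul_ppow_not_mem_signs p one_ne_zero)

/-- More generally: ANY realisation with one component `x ↦ p^a·x`, `a ≠ 0`, violates `LocalIsosInInd` at the model of record — every
valuation-MOVING strict move does (Joshi's Ind2 / collation isomorphisms rescale valuations: [J-III] Thm. 4.2.2.1 (4); [J-I] §10).
[folklore] -/
theorem pinned_not_localIsosInInd_of_ppow (𝔗 : TensorPacketDatum toyIndex)
    (G : 𝔇.Move → 𝔗.Arith → ∀ w : toyIndex.V, signShells.carrier w ≃ₗ[ℚ] signShells.carrier w) (g : 𝔇.Move) (y : 𝔗.Arith)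
    (w : toyIndex.V) {a : ℤ} (ha : a ≠ 0) (hG : G g y w = LinearEquiv.smulOfUnit (ppowUnit p a)) : ¬ LocalIsosInInd 𝔇 𝔗 G :=
  not_localIsosInInd_of_component 𝔇 𝔗 G g y w (by rw [hG]; exact smul_ppow_not_mem_signs p ha)
    (by rw [hG]; exact smul_ppow_not_mem_signs p ha)

omit hp in
/-- Sign-valued realisations DO satisfy `LocalIsosInInd` at the model of record (the condition is satisfiable there) — such moves act by
signs and fix every region (abc-iut-E-cx X-06; `Cor312Vol.IndTrivial.models_of_record_indTrivial` p429312). [folklore] -/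
theorem pinned_localIsosInInd_of_signs (𝔗 : TensorPacketDatum toyIndex)
    (G : 𝔇.Move → 𝔗.Arith → ∀ w : toyIndex.V, signShells.carrier w ≃ₗ[ℚ] signShells.carrier w)
    (hG : ∀ (g : 𝔇.Move) (y : 𝔗.Arith) (w : toyIndex.V), G g y w ∈ signs) : LocalIsosInInd 𝔇 𝔗 G :=
  localIsosInInd_of_forall_mem_ism 𝔇 𝔗 G hG

/-- **The (−) horn, conjunction form.** At abc-iut-w4-d101's pinned countermodel (setting `pinnedSetting p`, operator `orbitRegion p`,
q-datum `qDatum p`; S FAILS there, `pinnedSetting_not_pilotKummerIndRelated`), NO dictionary realised by §9.4 strict moves with (Ind)-local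
components can have `BaseIsThetaPilot ∧ DatumEquivariant ∧ StdReachable ∧ StandardPointIsQPilot`: the six hypotheses of
`pilotKummerIndRelated_of_strictMoves` (p430617) are jointly UNSATISFIABLE at the model of record (abc-iut-E-cx's X-02 in D-09 currency).
[folklore] -/
theorem pinned_strictMoves_not_stdIsQPilot (𝔗 : TensorPacketDatum toyIndex)
    (G : 𝔇.Move → 𝔗.Arith → ∀ w : toyIndex.V, signShells.carrier w ≃ₗ[ℚ] signShells.carrier w)
    (z : 𝔇.Move → toyIndex.Label → 𝔗.Arith) (hR : RealisedByStrictMoves 𝔇 𝔗 G z) (hG : LocalIsosInInd 𝔇 𝔗 G)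
    (hB : BaseIsThetaPilot 𝔇 (P := pinnedSetting p)) (hE : DatumEquivariant 𝔇) (hS : StdReachable 𝔇) :
    ¬ StandardPointIsQPilot (orbitRegion p) (qDatum p) 𝔇 := fun hQ =>
  pinnedSetting_not_pilotKummerIndRelated p
    (pilotKummerIndRelated_of_strictMoves (orbitRegion p) (qDatum p) 𝔇 𝔗 G z hR hG hB hE hS hQ)

/-- … equivalently: at the model of record a strict-move dictionary whose standard-point datum IS the q-datum up to `ρ` and which has
`BaseIsThetaPilot ∧ DatumEquivariant ∧ StdReachable` is NOT `LocalIsosInInd` — some move has a local component outside `{±1}`, i.e. MOVES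
valuations (the located sentence of E-LOCATION §L1 in D-09 currency). [folklore] -/
theorem pinned_not_localIsosInInd_of_stdIsQPilot (𝔗 : TensorPacketDatum toyIndex)
    (G : 𝔇.Move → 𝔗.Arith → ∀ w : toyIndex.V, signShells.carrier w ≃ₗ[ℚ] signShells.carrier w)
    (z : 𝔇.Move → toyIndex.Label → 𝔗.Arith) (hR : RealisedByStrictMoves 𝔇 𝔗 G z)
    (hB : BaseIsThetaPilot 𝔇 (P := pinnedSetting p)) (hE : DatumEquivariant 𝔇) (hS : StdReachable 𝔇)
    (hQ : StandardPointIsQPilot (orbitRegion p) (qDatum p) 𝔇) : ¬ LocalIsosInInd 𝔇 𝔗 G := fun hG =>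
  pinned_strictMoves_not_stdIsQPilot p 𝔇 𝔗 G z hR hG hB hE hS hQ

end MinusHorn

end Summit.ABC.IUTFork.Joshi

end
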